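import Mathlib
import Literature.Computability.AlgebraicComplexity.RealTauKnownCases

/-!
# `MatrixDescartes` census — the WINDOW-4 RULE in root form: INTERLACING of the two killed trinomials

HONEST FRAMING.  Object-search cell `pub-symmetroid`, door-A target `DoorA26 := PosRootLawAt 2 6 19`
(stmt-ValiantsHypothesis-19979; OPEN, typed, never asserted).  The cell's V = 20 certificates use the length-3 Descartes
layer (the Newton cone C25) of a hypothetical twenty; door-p1 g8's kernel pseudo-twenties (p549496, p551561, p551757)
show that layer — together with every Gram/rank row — is NOT complete at `K = 6`, and that the first killing information
is the LENGTH-4 layer: after Euler-killing the 17 other exponents (`card_posRoots_le_card_posRoots_twists`), every window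
of four consecutive coefficients is an alternating 4-nomial `g = a − b X^u + c X^(u+v) − e X^(u+v+w)` (`a,b,c,e > 0`,
`u,v,w ≥ 1`) that must have 3 positive roots.  THIS FILE types the exact extra content of «3 positive roots» in ROOT FORM
(desk R2154/R2159, «the typed 3-root region of the alternating 4-nomial»): with
`T₂ = u·b − (u+v)·c X^v + (u+v+w)·e X^(v+w)` (the kill of the exponent `0`, divided by `X^u`: `X·g' = −X^u·T₂`) and
`T₁ = (u+v+w)·a − (v+w)·b X^u + w·c X^(u+v)` (the kill of the top exponent: `(u+v+w)·g = T₁ + X·g'`),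

  `g` has ≥ 3 distinct positive roots  ⇒  there are `0 < s₁ < s₂` with `T₂(s₁) = T₂(s₂) = 0` and `T₁(s₁) < 0 < T₁(s₂)`

(`fourNomial_interlacing_of_three_posRoots`), i.e. the two positive roots of `T₂` INTERLACE the two positive roots
`h₁ < h₂` of `T₁` as `h₁ < s₁ < h₂ < s₂`.  The two C25 rows of the window say only that `T₁` and `T₂` each have two
positive roots; the interlacing is the discriminant-type condition that the log-linear instruments cannot see (its
log-linear hull is the C25 wedge).  Proof: Rolle gives critical points `s₁ ∈ (r₁,r₂)`, `s₂ ∈ (r₂,r₃)` of `g`; `T₂` has at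
most two positive roots (three monomials, Descartes), so `g' ≠ 0` elsewhere on `(0,∞)`; the mean value and intermediate
value theorems then give `g(s₁) < 0 < g(s₂)`, i.e. `T₁(s₁) < 0 < T₁(s₂)`.  This is the kernel form of val-sym-door-p2 g7's
paper FACT 1 (HOME/val-sym-door-p2/g7/think/THINK-g7.md §7, stated there with the kill-`b` twist `Φ = u·g − X·g'`; at a
critical point every Euler twist `α·g − X·g'` takes the value `α·g`, so the choice of twist is immaterial); their FACTS 2–3
(concentric normal form, the band `F₁(σ_BCD) < σ_ACD < F₂(σ_BCD)`) are not typed here.  Nothing here bounds any census count;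
`DoorA26` OPEN; nothing on `MatrixDescartes` (stmt-ValiantsHypothesis-18050) or `VP ≠ VNP`.

[folklore] Rolle, the mean value theorem and Descartes' bound for a trinomial; elementary.
-/

-- `Summit.ValiantsHypothesis.ValiantsHypothesis.…` repeats a component by the D-0017 layout
-- (single-conjunct summit), which the `dupNamespace` linter flags; the name is mandated.
set_option linter.dupNamespace false

namespace Summit.ValiantsHypothesis.ValiantsHypothesis.Theorems.LacunarySymmetroidMatrixDescartes.Census

open Polynomial Finset Set
open scoped BigOperators Polynomial

/-- A real polynomial with at most three monomials has at most two distinct positive roots (Descartes). [folklore] -/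
theorem card_posRoots_le_two_of_card_support_le_three (f : ℝ[X]) (hf : f ≠ 0) (h : f.support.card ≤ 3) :
    (f.roots.toFinset.filter (fun x => 0 < x)).card ≤ 2 := by
  have h1 : (f.roots.toFinset.filter (fun x => 0 < x)).card ≤ f.signVariations := by
    calc (f.roots.toFinset.filter (fun x => 0 < x)).card
        = (f.roots.filter (fun x => 0 < x)).toFinset.card := by rw [Multiset.toFinset_filter]
      _ ≤ (f.roots.filter (fun x => 0 < x)).card := Multiset.toFinset_card_le _
      _ = f.roots.countP (fun x => 0 < x) := (Multiset.countP_eq_card_filter _ _).symm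
      _ ≤ f.signVariations := f.roots_countP_pos_le_signVariations
  have h2 := Literature.Computability.AlgebraicComplexity.signVariations_lt_card_support hf
  omega

/-- A trinomial `C x * X^k + C y * X^m + C z * X^n` has at most two distinct positive roots. [folklore] -/
theorem card_posRoots_trinomial_le_two (k m n : ℕ) (x y z : ℝ)
    (h0 : (C x * X ^ k + C y * X ^ m + C z * X ^ n : ℝ[X]) ≠ 0) :
    ((C x * X ^ k + C y * X ^ m + C z * X ^ n : ℝ[X]).roots.toFinset.filter (fun t => 0 < t)).card ≤ 2 := by
  refine card_posRoots_le_two_of_card_support_le_three _ h0 ?_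
  calc (C x * X ^ k + C y * X ^ m + C z * X ^ n : ℝ[X]).support.card
      ≤ ({k, m, n} : Finset ℕ).card := card_le_card (support_trinomial_subset k m n x y z)
    _ ≤ 3 := Finset.card_le_three

/-- On an interval where a function with continuous derivative has NO critical point, it is strictly monotone in the
direction of its endpoint values: if `g p < g q` then `g' > 0` throughout, if `g q < g p` then `g' < 0` throughout.
[folklore] -/
theorem deriv_sign_of_no_critical {g g' : ℝ → ℝ} (hderiv : ∀ x, HasDerivAt g (g' x) x) (hc : Continuous g')
    {p q : ℝ} (hpq : p < q) (hne : ∀ x ∈ Ioo p q, g' x ≠ 0) :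
    (g p < g q → ∀ x ∈ Ioo p q, 0 < g' x) ∧ (g q < g p → ∀ x ∈ Ioo p q, g' x < 0) := by
  have hcont : Continuous g := continuous_iff_continuousAt.2 fun x => (hderiv x).continuousAt
  obtain ⟨ξ, hξ, hξ'⟩ := exists_hasDerivAt_eq_slope g g' hpq hcont.continuousOn
    (fun x _ => hderiv x)
  -- `g'` keeps one sign on `(p, q)` (intermediate value theorem)
  have hsame : ∀ x ∈ Ioo p q, ∀ y ∈ Ioo p q, 0 < g' x → 0 < g' y := by
    intro x hx y hy hgx
    by_contra hgy
    have hgy' : g' y ≤ 0 := not_lt.mp hgy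
    rcases hgy'.lt_or_eq with hlt | heq
    · obtain ⟨z, hz, hz0⟩ :=
        isPreconnected_Ioo.intermediate_value₂ hy hx hc.continuousOn continuousOn_const hlt.le hgx.le
      exact hne z hz hz0
    · exact hne y hy heq
  refine ⟨fun hlt x hx => ?_, fun hlt x hx => ?_⟩
  · have hslope : 0 < (g q - g p) / (q - p) := div_pos (by linarith) (by linarith)
    rw [← hξ'] at hslope
    exact hsame ξ hξ x hx hslope
  · have hslope : (g q - g p) / (q - p) < 0 := div_neg_of_neg_of_pos (by linarith) (by linarith)
    rw [← hξ'] at hslope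
    by_contra hgx
    rcases (not_lt.mp hgx).lt_or_eq with hpos | hzero
    · have := hsame x hx ξ hξ hpos; linarith
    · exact hne x hx hzero.symm

/-- **WINDOW-4 RULE (interlacing form).**  For `u, v, w ≥ 1` and `a, b > 0`: if the alternating 4-nomial
`a − b X^u + c X^(u+v) − e X^(u+v+w)` has at least three distinct positive roots, then the trinomial
`T₂(x) = u b − (u+v) c x^v + (u+v+w) e x^(v+w)` has two positive roots `s₁ < s₂` at which
`T₁(x) = (u+v+w) a − (v+w) b x^u + w c x^(u+v)` is respectively NEGATIVE and POSITIVE — so the two positive roots of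
`T₁` interlace them: `h₁ < s₁ < h₂ < s₂`. [folklore] -/
theorem fourNomial_interlacing_of_three_posRoots {u v w : ℕ} (hu : 0 < u) (hv : 0 < v) (hw : 0 < w)
    {a b c e : ℝ} (ha : 0 < a) (hb : 0 < b)
    (h3 : 3 ≤ ((C a - C b * X ^ u + C c * X ^ (u + v) - C e * X ^ (u + v + w)).roots.toFinset.filter
      (fun x => 0 < x)).card) :
    ∃ s₁ s₂ : ℝ, 0 < s₁ ∧ s₁ < s₂ ∧
      (u : ℝ) * b - ((u : ℝ) + v) * c * s₁ ^ v + ((u : ℝ) + v + w) * e * s₁ ^ (v + w) = 0 ∧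
      (u : ℝ) * b - ((u : ℝ) + v) * c * s₂ ^ v + ((u : ℝ) + v + w) * e * s₂ ^ (v + w) = 0 ∧
      ((u : ℝ) + v + w) * a - ((v : ℝ) + w) * b * s₁ ^ u + (w : ℝ) * c * s₁ ^ (u + v) < 0 ∧
      0 < ((u : ℝ) + v + w) * a - ((v : ℝ) + w) * b * s₂ ^ u + (w : ℝ) * c * s₂ ^ (u + v) := by
  obtain ⟨u₀, rfl⟩ : ∃ u₀, u = u₀ + 1 := ⟨u - 1, by omega⟩
  -- the 4-nomial as a real function, its derivative, and the killed trinomial `T₂`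
  set gp : ℝ[X] := C a - C b * X ^ (u₀ + 1) + C c * X ^ (u₀ + 1 + v) - C e * X ^ (u₀ + 1 + v + w) with hgp
  set g : ℝ → ℝ := fun x => a - b * x ^ (u₀ + 1) + c * x ^ (u₀ + 1 + v) - e * x ^ (u₀ + 1 + v + w) with hgdef
  set g' : ℝ → ℝ := fun x => -(b * ((u₀ : ℝ) + 1) * x ^ u₀) + c * ((u₀ : ℝ) + 1 + v) * x ^ (u₀ + v)
      - e * ((u₀ : ℝ) + 1 + v + w) * x ^ (u₀ + v + w) with hg'def
  set T₂ : ℝ → ℝ := fun x => ((u₀ : ℝ) + 1) * b - (((u₀ : ℝ) + 1) + v) * c * x ^ v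
      + (((u₀ : ℝ) + 1) + v + w) * e * x ^ (v + w) with hT₂def
  have hg_eval : ∀ x, gp.eval x = g x := by
    intro x; simp [hgp, hgdef]
  have hderiv : ∀ x, HasDerivAt g (g' x) x := by
    intro x
    have h1 := ((hasDerivAt_pow (u₀ + 1) x).const_mul b)
    have h2 := ((hasDerivAt_pow (u₀ + 1 + v) x).const_mul c)
    have h4 := ((hasDerivAt_pow (u₀ + 1 + v + w) x).const_mul e)
    have hraw := (((hasDerivAt_const x a).sub h1).add h2).sub h4
    refine hraw.congr_deriv ?_
    have e1 : u₀ + 1 + v - 1 = u₀ + v := by omega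
    have e2 : u₀ + 1 + v + w - 1 = u₀ + v + w := by omega
    rw [Nat.add_sub_cancel, e1, e2]
    simp only [hg'def]
    push_cast
    ring
  have hc' : Continuous g' := by rw [hg'def]; fun_prop
  have hcont : Continuous g := continuous_iff_continuousAt.2 fun x => (hderiv x).continuousAt
  have hderiv_eq : deriv g = g' := funext fun x => (hderiv x).deriv
  -- `g' x = -(x^u₀ · T₂ x)` and `(u+v+w)·g x - x·g' x = T₁ x`
  have hg'T : ∀ x, g' x = -(x ^ u₀ * T₂ x) := by
    intro x; simp only [hg'def, hT₂def]; ring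
  have hT1 : ∀ x, (((u₀ : ℝ) + 1) + v + w) * a - ((v : ℝ) + w) * b * x ^ (u₀ + 1) + (w : ℝ) * c * x ^ (u₀ + 1 + v)
      = (((u₀ : ℝ) + 1) + v + w) * g x - x * g' x := by
    intro x; simp only [hgdef, hg'def]; ring
  -- three distinct positive roots r 0 < r 1 < r 2
  have hgp0 : gp ≠ 0 := by
    intro h0
    have : (gp.roots.toFinset.filter (fun x => 0 < x)).card = 0 := by rw [h0]; simp
    omega
  obtain ⟨t, ht, htc⟩ := Finset.exists_subset_card_eq h3
  have hroot : ∀ x ∈ t, 0 < x ∧ g x = 0 := by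
    intro x hx
    have hx' := ht hx
    rw [Finset.mem_filter, Multiset.mem_toFinset, mem_roots hgp0, IsRoot.def, hg_eval] at hx'
    exact ⟨hx'.2, hx'.1⟩
  let r : Fin 3 → ℝ := fun i => t.orderEmbOfFin htc i
  have hr_mem : ∀ i, r i ∈ t := fun i => Finset.orderEmbOfFin_mem t htc i
  have hr_mono : StrictMono r := fun i j hij => (t.orderEmbOfFin htc).strictMono hij
  have h01 : r 0 < r 1 := hr_mono (by decide)
  have h12 : r 1 < r 2 := hr_mono (by decide)
  have hr0 : 0 < r 0 := (hroot _ (hr_mem 0)).1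
  have hr1 : 0 < r 1 := hr0.trans h01
  have hgr : ∀ i, g (r i) = 0 := fun i => (hroot _ (hr_mem i)).2
  -- Rolle: critical points s₁ ∈ (r 0, r 1), s₂ ∈ (r 1, r 2)
  obtain ⟨s₁, hs₁, hs₁'⟩ := exists_deriv_eq_zero h01 hcont.continuousOn ((hgr 0).trans (hgr 1).symm)
  obtain ⟨s₂, hs₂, hs₂'⟩ := exists_deriv_eq_zero h12 hcont.continuousOn ((hgr 1).trans (hgr 2).symm)
  rw [hderiv_eq] at hs₁' hs₂'
  have hs₁0 : 0 < s₁ := hr0.trans hs₁.1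
  have hs₂0 : 0 < s₂ := hr1.trans hs₂.1
  have hs12 : s₁ < s₂ := hs₁.2.trans hs₂.1
  have hcrit : ∀ x, 0 < x → (g' x = 0 ↔ T₂ x = 0) := by
    intro x hx
    rw [hg'T x, neg_eq_zero, mul_eq_zero]
    exact ⟨fun h => h.resolve_left (pow_ne_zero _ hx.ne'), fun h => Or.inr h⟩
  have hT₂s₁ : T₂ s₁ = 0 := (hcrit s₁ hs₁0).1 hs₁'
  have hT₂s₂ : T₂ s₂ = 0 := (hcrit s₂ hs₂0).1 hs₂'
  -- `T₂` as a trinomial polynomial; at most two positive roots, so they are exactly `s₁, s₂`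
  set Tp : ℝ[X] := C (((u₀ : ℝ) + 1) * b) * X ^ 0 + C (-((((u₀ : ℝ) + 1) + v) * c)) * X ^ v
      + C ((((u₀ : ℝ) + 1) + v + w) * e) * X ^ (v + w) with hTp
  have hTp_eval : ∀ x, Tp.eval x = T₂ x := by
    intro x; simp only [hTp, hT₂def, eval_add, eval_mul, eval_C, eval_pow, eval_X, pow_zero, mul_one]; ring
  have hTp0 : Tp ≠ 0 := by
    intro h0
    have h := congrArg (fun p : ℝ[X] => p.eval 0) h0
    simp only [hTp_eval, eval_zero, hT₂def, zero_pow hv.ne', zero_pow (show v + w ≠ 0 by omega),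
      mul_zero, sub_zero, add_zero] at h
    have : (0 : ℝ) < ((u₀ : ℝ) + 1) * b := by positivity
    linarith
  have hTcard : (Tp.roots.toFinset.filter (fun y => 0 < y)).card ≤ 2 :=
    card_posRoots_trinomial_le_two 0 v (v + w) _ _ _ hTp0
  have hcrit_mem : ∀ x, 0 < x → g' x = 0 → x = s₁ ∨ x = s₂ := by
    intro x hx hx'
    by_contra hne
    have hne1 : x ≠ s₁ := fun h => hne (Or.inl h)
    have hne2 : x ≠ s₂ := fun h => hne (Or.inr h)
    have hsub : ({x, s₁, s₂} : Finset ℝ) ⊆ Tp.roots.toFinset.filter (fun y => 0 < y) := by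
      intro y hy
      simp only [Finset.mem_insert, Finset.mem_singleton] at hy
      rw [Finset.mem_filter, Multiset.mem_toFinset, mem_roots hTp0, IsRoot.def, hTp_eval]
      rcases hy with rfl | rfl | rfl
      · exact ⟨(hcrit y hx).1 hx', hx⟩
      · exact ⟨hT₂s₁, hs₁0⟩
      · exact ⟨hT₂s₂, hs₂0⟩
    have hcard3 : ({x, s₁, s₂} : Finset ℝ).card = 3 := by
      rw [Finset.card_insert_of_notMem, Finset.card_insert_of_notMem, Finset.card_singleton]
      · simpa using hs12.ne
      · simp only [Finset.mem_insert, Finset.mem_singleton, not_or]; exact ⟨hne1, hne2⟩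
    have := Finset.card_le_card hsub
    omega
  have hne1 : ∀ x ∈ Ioo 0 s₁, g' x ≠ 0 := by
    intro x hx h0
    rcases hcrit_mem x hx.1 h0 with h | h
    · exact hx.2.ne h
    · exact (hx.2.trans hs12).ne h
  have hne2 : ∀ x ∈ Ioo s₁ s₂, g' x ≠ 0 := by
    intro x hx h0
    rcases hcrit_mem x (hs₁0.trans hx.1) h0 with h | h
    · exact hx.1.ne' h
    · exact hx.2.ne h
  have hg0 : g 0 = a := by
    simp only [hgdef, zero_pow (Nat.succ_ne_zero _), zero_pow (show u₀ + 1 + v ≠ 0 by omega),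
      zero_pow (show u₀ + 1 + v + w ≠ 0 by omega), mul_zero, sub_zero, add_zero]
  -- sign of `g` at `s₁` (negative) and at `s₂` (positive)
  have hgs₁ : g s₁ < 0 := by
    by_contra hge'
    have hge : 0 ≤ g s₁ := not_lt.mp hge'
    -- `g' < 0` on `(0, r 0)` (g falls from `a` to `0`)
    have hA := (deriv_sign_of_no_critical hderiv hc' hr0 (fun x hx => hne1 x ⟨hx.1, hx.2.trans hs₁.1⟩)).2
      (by rw [hgr 0, hg0]; exact ha)
    rcases hge.lt_or_eq with hgt | heq
    · -- `g' > 0` on `(r 0, s₁)`; continuity of `g'` then forces a zero in between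
      have hB := (deriv_sign_of_no_critical hderiv hc' hs₁.1 (fun x hx => hne1 x ⟨hr0.trans hx.1, hx.2⟩)).1
        (by rw [hgr 0]; exact hgt)
      have hx₁ : r 0 / 2 ∈ Ioo 0 (r 0) := ⟨by linarith, by linarith⟩
      have hx₂ : (r 0 + s₁) / 2 ∈ Ioo (r 0) s₁ := ⟨by linarith [hs₁.1], by linarith [hs₁.1]⟩
      have h1 := hA _ hx₁
      have h2 := hB _ hx₂
      have hx12 : r 0 / 2 ≤ (r 0 + s₁) / 2 := by linarith [hs₁.1]
      obtain ⟨z, hz, hz0⟩ := intermediate_value_Icc hx12 hc'.continuousOn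
        (show (0 : ℝ) ∈ Icc (g' (r 0 / 2)) (g' ((r 0 + s₁) / 2)) from ⟨h1.le, h2.le⟩)
      exact hne1 z ⟨hx₁.1.trans_le hz.1, hz.2.trans_lt hx₂.2⟩ hz0
    · -- `g s₁ = 0 = g (r 0)`: Rolle gives a critical point in `(r 0, s₁)`
      obtain ⟨z, hz, hz0⟩ := exists_deriv_eq_zero hs₁.1 hcont.continuousOn (by rw [hgr 0]; exact heq)
      rw [hderiv_eq] at hz0
      exact hne1 z ⟨hr0.trans hz.1, hz.2⟩ hz0
  have hgs₂ : 0 < g s₂ := by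
    by_contra hle'
    have hle : g s₂ ≤ 0 := not_lt.mp hle'
    have hA := (deriv_sign_of_no_critical hderiv hc' hs₁.2 (fun x hx => hne2 x ⟨hx.1, hx.2.trans hs₂.1⟩)).1
      (by rw [hgr 1]; exact hgs₁)
    rcases hle.lt_or_eq with hlt | heq
    · have hB := (deriv_sign_of_no_critical hderiv hc' hs₂.1 (fun x hx => hne2 x ⟨hs₁.2.trans hx.1, hx.2⟩)).2
        (by rw [hgr 1]; exact hlt)
      have hx₁ : (s₁ + r 1) / 2 ∈ Ioo s₁ (r 1) := ⟨by linarith [hs₁.2], by linarith [hs₁.2]⟩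
      have hx₂ : (r 1 + s₂) / 2 ∈ Ioo (r 1) s₂ := ⟨by linarith [hs₂.1], by linarith [hs₂.1]⟩
      have h1 := hA _ hx₁
      have h2 := hB _ hx₂
      have hx12 : (s₁ + r 1) / 2 ≤ (r 1 + s₂) / 2 := by linarith [hs₁.2, hs₂.1]
      obtain ⟨z, hz, hz0⟩ := intermediate_value_Icc' hx12 hc'.continuousOn
        (show (0 : ℝ) ∈ Icc (g' ((r 1 + s₂) / 2)) (g' ((s₁ + r 1) / 2)) from ⟨h2.le, h1.le⟩)
      exact hne2 z ⟨hx₁.1.trans_le hz.1, hz.2.trans_lt hx₂.2⟩ hz0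
    · obtain ⟨z, hz, hz0⟩ := exists_deriv_eq_zero hs₂.1 hcont.continuousOn (by rw [hgr 1]; exact heq.symm)
      rw [hderiv_eq] at hz0
      exact hne2 z ⟨hs₁.2.trans hz.1, hz.2⟩ hz0
  -- assemble (`u = u₀ + 1` as a real cast)
  have hu1 : ((u₀ + 1 : ℕ) : ℝ) = (u₀ : ℝ) + 1 := by push_cast; ring
  refine ⟨s₁, s₂, hs₁0, hs12, ?_, ?_, ?_, ?_⟩
  · have h := hT₂s₁; simp only [hT₂def] at h; rw [hu1]; linarith
  · have h := hT₂s₂; simp only [hT₂def] at h; rw [hu1]; linarith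
  · have h := hT1 s₁
    rw [hs₁', mul_zero, sub_zero] at h
    have hU : (0 : ℝ) < ((u₀ : ℝ) + 1) + v + w := by positivity
    have hneg : (((u₀ : ℝ) + 1) + v + w) * g s₁ < 0 := mul_neg_of_pos_of_neg hU hgs₁
    rw [hu1]; linarith
  · have h := hT1 s₂
    rw [hs₂', mul_zero, sub_zero] at h
    have hU : (0 : ℝ) < ((u₀ : ℝ) + 1) + v + w := by positivity
    have hpos : 0 < (((u₀ : ℝ) + 1) + v + w) * g s₂ := mul_pos hU hgs₂
    rw [hu1]; linarith

/-- **WINDOW-4 RULE, kill-`b` form** (door-p2 g7's FACT 1 verbatim, THINK-g7.md §7): under the same hypotheses the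
kill-`b` twist `Φ(x) = u·a − v·c x^(u+v) + (v+w)·e x^(u+v+w)` (`= u·g − X·g'`, CONCENTRIC with `T₂` — their FACT 2) is
negative at `s₁` and positive at `s₂`, the two positive roots of `T₂`.  (At a root `s` of `T₂` one has
`(u+v+w)·Φ(s) = u·T₁(s)`.) [folklore] -/
theorem fourNomial_interlacing_of_three_posRoots' {u v w : ℕ} (hu : 0 < u) (hv : 0 < v) (hw : 0 < w)
    {a b c e : ℝ} (ha : 0 < a) (hb : 0 < b)
    (h3 : 3 ≤ ((C a - C b * X ^ u + C c * X ^ (u + v) - C e * X ^ (u + v + w)).roots.toFinset.filter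
      (fun x => 0 < x)).card) :
    ∃ s₁ s₂ : ℝ, 0 < s₁ ∧ s₁ < s₂ ∧
      (u : ℝ) * b - ((u : ℝ) + v) * c * s₁ ^ v + ((u : ℝ) + v + w) * e * s₁ ^ (v + w) = 0 ∧
      (u : ℝ) * b - ((u : ℝ) + v) * c * s₂ ^ v + ((u : ℝ) + v + w) * e * s₂ ^ (v + w) = 0 ∧
      (u : ℝ) * a - (v : ℝ) * c * s₁ ^ (u + v) + ((v : ℝ) + w) * e * s₁ ^ (u + v + w) < 0 ∧
      0 < (u : ℝ) * a - (v : ℝ) * c * s₂ ^ (u + v) + ((v : ℝ) + w) * e * s₂ ^ (u + v + w) := by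
  obtain ⟨s₁, s₂, h1, h12, hT1, hT2, hN, hP⟩ := fourNomial_interlacing_of_three_posRoots hu hv hw ha hb h3
  refine ⟨s₁, s₂, h1, h12, hT1, hT2, ?_, ?_⟩
  · -- `U·Φ(s₁) = u·T₁(s₁) + (v+w)·s₁^u·T₂(s₁) = u·T₁(s₁) < 0`
    have hU : (0 : ℝ) < (u : ℝ) + v + w := by positivity
    have hu' : (0 : ℝ) < u := by exact_mod_cast hu
    have key : ((u : ℝ) + v + w) * ((u : ℝ) * a - (v : ℝ) * c * s₁ ^ (u + v) + ((v : ℝ) + w) * e * s₁ ^ (u + v + w))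
        = (u : ℝ) * (((u : ℝ) + v + w) * a - ((v : ℝ) + w) * b * s₁ ^ u + (w : ℝ) * c * s₁ ^ (u + v))
          + ((v : ℝ) + w) * s₁ ^ u * ((u : ℝ) * b - ((u : ℝ) + v) * c * s₁ ^ v + ((u : ℝ) + v + w) * e * s₁ ^ (v + w)) := by
      ring
    rw [hT1, mul_zero, add_zero] at key
    have : ((u : ℝ) + v + w) * ((u : ℝ) * a - (v : ℝ) * c * s₁ ^ (u + v) + ((v : ℝ) + w) * e * s₁ ^ (u + v + w)) < 0 := by
      rw [key]; exact mul_neg_of_pos_of_neg hu' hN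
    by_contra hge
    have := mul_nonneg hU.le (not_lt.mp hge)
    linarith
  · have hU : (0 : ℝ) < (u : ℝ) + v + w := by positivity
    have hu' : (0 : ℝ) < u := by exact_mod_cast hu
    have key : ((u : ℝ) + v + w) * ((u : ℝ) * a - (v : ℝ) * c * s₂ ^ (u + v) + ((v : ℝ) + w) * e * s₂ ^ (u + v + w))
        = (u : ℝ) * (((u : ℝ) + v + w) * a - ((v : ℝ) + w) * b * s₂ ^ u + (w : ℝ) * c * s₂ ^ (u + v))
          + ((v : ℝ) + w) * s₂ ^ u * ((u : ℝ) * b - ((u : ℝ) + v) * c * s₂ ^ v + ((u : ℝ) + v + w) * e * s₂ ^ (v + w)) := by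
      ring
    rw [hT2, mul_zero, add_zero] at key
    have : 0 < ((u : ℝ) + v + w) * ((u : ℝ) * a - (v : ℝ) * c * s₂ ^ (u + v) + ((v : ℝ) + w) * e * s₂ ^ (u + v + w)) := by
      rw [key]; exact mul_pos hu' hP
    by_contra hle
    have := mul_nonpos_of_nonneg_of_nonpos (α := ℝ) hU.le (not_lt.mp hle)
    linarith

/-- GLUE for the census emitters: stripping a non-zero constant and a power of `X` does not change the set of
POSITIVE roots — after `card_posRoots_le_card_posRoots_twists` kills the 17 exponents outside a window, the killed polynomial is
`C κ * X^m * (a window 4-nomial)`, and this lemma moves the root count onto the 4-nomial of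
`fourNomial_interlacing_of_three_posRoots`. [folklore] -/
theorem card_posRoots_C_mul_X_pow_mul {κ : ℝ} (hκ : κ ≠ 0) (m : ℕ) (g : ℝ[X]) :
    ((C κ * X ^ m * g).roots.toFinset.filter (fun x => 0 < x)).card
      = (g.roots.toFinset.filter (fun x => 0 < x)).card := by
  by_cases hg : g = 0
  · subst hg; simp
  have hX : (X ^ m : ℝ[X]) ≠ 0 := pow_ne_zero _ X_ne_zero
  have hC : (C κ : ℝ[X]) ≠ 0 := C_ne_zero.mpr hκ
  have hCX : (C κ * X ^ m : ℝ[X]) ≠ 0 := mul_ne_zero hC hX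
  have h0 : (C κ * X ^ m * g : ℝ[X]) ≠ 0 := mul_ne_zero hCX hg
  congr 1
  ext x
  simp only [Finset.mem_filter, Multiset.mem_toFinset, mem_roots h0, mem_roots hg, IsRoot.def, eval_mul, eval_C,
    eval_pow, eval_X, mul_eq_zero]
  constructor
  · rintro ⟨h | h, hx⟩
    · rcases h with h | h
      · exact absurd h hκ
      · exact absurd (pow_eq_zero_iff'.mp h).1 hx.ne'
    · exact ⟨h, hx⟩
  · rintro ⟨h, hx⟩
    exact ⟨Or.inr h, hx⟩

end Summit.ValiantsHypothesis.ValiantsHypothesis.Theorems.LacunarySymmetroidMatrixDescartes.Census
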